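import Summits.QuantumAdvantage.QuantumAdvantage.Theorems.OddPrimeWalkCounterGadget

/-!
# Item stmt-QuantumAdvantage-24098 `CounterAffinePairLaw` — the COUNTER-AFFINE PAIR LAW of the u-walk game (route OddPrimeWalk, support, rank 9)

Cell qa-qnc0; planner qa-qnc0-p2 g30 (ROUND-30 §2, THM 30-A, brief P2-30a); prover qn-prover-3 g19.

THEOREM (`oddPrimeWalk_counterAffinePairLaw`).  Fix `q` with `q % 3 ≠ 0`.  There are `θ_q < 1` and `m₀` (here `m₀ = gadL q = 3(1 + 2q)`,
`θ_q = 1 − 2^(−2·gadL q)/81`) such that: if across a separator `m` (both sides `≥ m₀` bits) every cut `g ≤ m` reads the bits `≥ m`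
only through `ρ = #(far ones) mod q` and an `𝔽₂`-affine function `a₀ ⊕ ⟨A, ·⟩` of them whose data `(a₀, A)` depends arbitrarily on
the cut's own bits `< m` and on `ρ`, and symmetrically for the cuts `g > m`, then `#WIN ≤ θ_q·2ⁿ`.  `q = 1` is item 24030
`FarAffinePairLaw`; the class contains the (CORR-η) extremiser family of ROUND-29 §3.5 (literal parities × functions of `|u| mod 5`).

PROOF.  `counter_exists_lose` (file `OddPrimeWalkCounterGadget`: the planner's odd-configuration identity `configParity` on the
`9 × 9` design of three zero-sum gadget triples per side, all nine slots of a side in ONE foreign-weight class mod `q`) for the bases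
`rA = extS SA gA`, `rB = extS SB gB` parametrised by the free near bits `SA = [0, m − gadL q)` and the free far bits
`SB = [m + gadL q, n)`; AVERAGING (`pow_le_card_lose_counter`, verbatim the double count of `pow_le_card_lose_design`, p698126): every
parameter pair has a lost slot pair and each of the `81` slot pairs is injective in the parameters (§0), so
`2^(m − gadL q)·2^(n − m − gadL q) ≤ 81·#LOSE`; arithmetic.
This module is THESES-FREE (it does not import the route file; the closer is typed against the item's literal signature), so the route
file may link it as `CounterAffinePairLaw_holds` once the decl is rendered.
WHAT THIS IS NOT: instrument — a bankable law for STRUCTURED far reading (affine per foreign-weight class); it does not touch the dense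
cruxes 23029/23109 (frontier (CORR-η) / (ELIM₂), ROUND-30 §3); the constant is not optimised; separation NOT moved.
-/

namespace Summit.QuantumAdvantage.AdviceFreeQNC0.OddConfig

open Finset Classical

variable {n : ℕ}

/-! ### §0 Injectivity plumbing (route-independent copies of `OddPrimeWalkFarDegreePairLaw` §1, kept private) -/

/-- extension by zero is injective. -/
private theorem extS_inj (S : Finset (Fin n)) {g g' : Fin S.card → Bool} (h : extS S g = extS S g') : g = g' := by
  funext q
  have := congrFun h (S.equivFin.symm q).1
  rwa [extS_apply_symm, extS_apply_symm] at this

/-- a glued pair with a near-supported first slot and a far-supported second slot determines both slots. -/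
private theorem glue_inj_supp {m : ℕ} {s s' t t' : Fin n → Bool}
    (hs : ∀ k : Fin n, ¬ k.val < m → s k = false) (hs' : ∀ k : Fin n, ¬ k.val < m → s' k = false)
    (ht : ∀ k : Fin n, k.val < m → t k = false) (ht' : ∀ k : Fin n, k.val < m → t' k = false)
    (h : glue m s t = glue m s' t') : s = s' ∧ t = t' := by
  constructor
  · funext k
    by_cases hk : k.val < m
    · have := congrFun h k; simpa [glue, hk] using this
    · rw [hs k hk, hs' k hk]
  · funext k
    by_cases hk : k.val < m
    · rw [ht k hk, ht' k hk]
    · have := congrFun h k; simpa [glue, hk] using this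

/-- right cancellation of `addV`. -/
private theorem addV_cancel_right {s s' v : Fin n → Bool} (h : addV s v = addV s' v) : s = s' := by
  have h2 : addV (addV s v) v = addV (addV s' v) v := by rw [h]
  rwa [addV_assoc, addV_self, addV_zeroV, addV_assoc, addV_self, addV_zeroV] at h2

/-! ### §1 Averaging over the design parametrisation -/

section Averaging

variable {m q : ℕ} (c : ℕ) (y : Fin (n + 1) → (Fin n → Bool) → Bool)

/-- **AVERAGING.**  With the counter designs of `counter_exists_lose` parametrised by the free near bits (below `m − gadL q`) and the
free far bits (from `m + gadL q` on), every parameter pair has a lost slot pair and each slot pair is injective in the parameters: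
`2^{m − gadL q}·2^{n − m − gadL q} ≤ 81·#LOSE`. -/
theorem pow_le_card_lose_counter (hq : q % 3 ≠ 0) (hLm : gadL q ≤ m) (hnB : m + gadL q ≤ n)
    (hA : ∀ g : Fin (n + 1), g.val ≤ m → ∃ a₀ : (Fin n → Bool) → ℕ → Bool, ∃ A : (Fin n → Bool) → ℕ → Finset (Fin n),
      ∀ u : Fin n → Bool, y g u = Bool.xor (a₀ (fun i => decide (i.val < m) && u i)
        ((Finset.univ.filter fun i : Fin n => m ≤ i.val ∧ u i = true).card % q))
        (decide (((A (fun i => decide (i.val < m) && u i)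
          ((Finset.univ.filter fun i : Fin n => m ≤ i.val ∧ u i = true).card % q)).filter
            fun i : Fin n => m ≤ i.val ∧ u i = true).card % 2 = 1)))
    (hB : ∀ g : Fin (n + 1), m < g.val → ∃ a₀ : (Fin n → Bool) → ℕ → Bool, ∃ A : (Fin n → Bool) → ℕ → Finset (Fin n),
      ∀ u : Fin n → Bool, y g u = Bool.xor (a₀ (fun i => decide (m ≤ i.val) && u i)
        ((Finset.univ.filter fun i : Fin n => i.val < m ∧ u i = true).card % q))
        (decide (((A (fun i => decide (m ≤ i.val) && u i)
          ((Finset.univ.filter fun i : Fin n => i.val < m ∧ u i = true).card % q)).filter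
            fun i : Fin n => i.val < m ∧ u i = true).card % 2 = 1))) :
    2 ^ (m - gadL q) * 2 ^ (n - (m + gadL q)) ≤
      81 * (univ.filter fun u : Fin n → Bool => ¬ ringWinU c y u = true).card := by
  set SA : Finset (Fin n) := ivl n 0 (m - gadL q) with hSA
  set SB : Finset (Fin n) := ivl n (m + gadL q) (n - (m + gadL q)) with hSB
  have hcA : SA.card = m - gadL q := card_ivl (by omega)
  have hcB : SB.card = n - (m + gadL q) := card_ivl (by omega)
  set R : ((Fin SA.card → Bool) × (Fin SB.card → Bool)) → (Fin 3 × Fin 3) × (Fin 3 × Fin 3) → Prop :=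
    fun x ij => ringWinU c y (glue m (slotA m q (extS SA x.1) ij.1) (slotB m q (extS SB x.2) ij.2)) = false with hR
  -- supports of the bases
  have hrA : ∀ (gA : Fin SA.card → Bool) (k : Fin n), extS SA gA k = true → k.val < m - gadL q := by
    intro gA k hk
    have : k ∈ SA := by by_contra h; rw [extS_apply_not_mem _ h] at hk; exact Bool.false_ne_true hk
    rw [hSA, ivl, mem_filter] at this; omega
  have hrB : ∀ (gB : Fin SB.card → Bool) (k : Fin n), extS SB gB k = true → m + gadL q ≤ k.val := by
    intro gB k hk
    have : k ∈ SB := by by_contra h; rw [extS_apply_not_mem _ h] at hk; exact Bool.false_ne_true hk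
    rw [hSB, ivl, mem_filter] at this; omega
  -- (1) every parameter pair has a lost slot pair
  have h1 : ∀ x, 1 ≤ (univ.filter fun ij => R x ij).card := by
    intro x
    obtain ⟨i, j, hij⟩ := counter_exists_lose hq c y hLm hnB hA hB (extS SA x.1) (extS SB x.2) (hrA x.1) (hrB x.2)
    exact card_pos.mpr ⟨(i, j), mem_filter.mpr ⟨mem_univ _, hij⟩⟩
  -- (2) each slot pair is injective in the parameters and lands in the lost inputs
  have h2 : ∀ ij, (univ.filter fun x => R x ij).card ≤ (univ.filter fun u : Fin n → Bool => ¬ ringWinU c y u = true).card := by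
    intro ij
    refine card_le_card_of_injOn (fun x => glue m (slotA m q (extS SA x.1) ij.1) (slotB m q (extS SB x.2) ij.2)) ?_ ?_
    · intro x hx
      have h := (mem_filter.mp (mem_coe.mp hx)).2
      exact mem_coe.mpr (mem_filter.mpr ⟨mem_univ _, by rw [h]; exact Bool.false_ne_true⟩)
    · intro x _ x' _ he
      obtain ⟨ha, hb⟩ := glue_inj_supp (slotA_far hLm (extS SA x.1) (hrA x.1) ij.1) (slotA_far hLm (extS SA x'.1) (hrA x'.1) ij.1)
        (slotB_near (extS SB x.2) (hrB x.2) ij.2) (slotB_near (extS SB x'.2) (hrB x'.2) ij.2) he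
      simp only [slotA, slotB] at ha hb
      exact Prod.ext (extS_inj SA (addV_cancel_right ha)) (extS_inj SB (addV_cancel_right hb))
  -- (3) double count
  calc 2 ^ (m - gadL q) * 2 ^ (n - (m + gadL q))
      = (univ : Finset ((Fin SA.card → Bool) × (Fin SB.card → Bool))).card := by
        rw [card_univ, Fintype.card_prod, Fintype.card_fun, Fintype.card_fun, Fintype.card_bool, Fintype.card_fin,
          Fintype.card_fin, hcA, hcB]
    _ = ∑ x : (Fin SA.card → Bool) × (Fin SB.card → Bool), 1 := by rw [sum_const, smul_eq_mul, mul_one]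
    _ ≤ ∑ x : (Fin SA.card → Bool) × (Fin SB.card → Bool), (univ.filter fun ij => R x ij).card := sum_le_sum fun x _ => h1 x
    _ = ∑ ij : (Fin 3 × Fin 3) × (Fin 3 × Fin 3), (univ.filter fun x => R x ij).card := by
        simp_rw [card_filter]; exact sum_comm
    _ ≤ ∑ ij : (Fin 3 × Fin 3) × (Fin 3 × Fin 3),
          (univ.filter fun u : Fin n → Bool => ¬ ringWinU c y u = true).card := sum_le_sum fun ij _ => h2 ij
    _ = _ := by rw [sum_const, smul_eq_mul, card_univ]; simp

end Averaging

/-! ### §2 The counter-affine pair law -/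

/-- **COUNTER-AFFINE PAIR LAW** (item stmt-QuantumAdvantage-24098, engine form): for `q % 3 ≠ 0`, with
`θ_q = 1 − 2^{−2·gadL q}/81` and `m₀ = gadL q = 3(1 + 2q)`. -/
theorem counterAffinePairLaw_card (q : ℕ) (hq : q % 3 ≠ 0) : ∃ θ : ℝ, θ < 1 ∧ ∃ m₀ : ℕ, ∀ n m c : ℕ,
    ∀ y : Fin (n + 1) → (Fin n → Bool) → Bool, m₀ ≤ m → m + m₀ ≤ n →
    (∀ g : Fin (n + 1), g.val ≤ m → ∃ a₀ : (Fin n → Bool) → ℕ → Bool, ∃ A : (Fin n → Bool) → ℕ → Finset (Fin n),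
      ∀ u : Fin n → Bool, y g u = Bool.xor (a₀ (fun i => decide (i.val < m) && u i)
        ((Finset.univ.filter fun i : Fin n => m ≤ i.val ∧ u i = true).card % q))
        (decide (((A (fun i => decide (i.val < m) && u i)
          ((Finset.univ.filter fun i : Fin n => m ≤ i.val ∧ u i = true).card % q)).filter
            fun i : Fin n => m ≤ i.val ∧ u i = true).card % 2 = 1))) →
    (∀ g : Fin (n + 1), m < g.val → ∃ a₀ : (Fin n → Bool) → ℕ → Bool, ∃ A : (Fin n → Bool) → ℕ → Finset (Fin n),
      ∀ u : Fin n → Bool, y g u = Bool.xor (a₀ (fun i => decide (m ≤ i.val) && u i)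
        ((Finset.univ.filter fun i : Fin n => i.val < m ∧ u i = true).card % q))
        (decide (((A (fun i => decide (m ≤ i.val) && u i)
          ((Finset.univ.filter fun i : Fin n => i.val < m ∧ u i = true).card % q)).filter
            fun i : Fin n => i.val < m ∧ u i = true).card % 2 = 1))) →
    ((univ.filter fun u : Fin n → Bool => Summit.QuantumAdvantage.AdviceFreeQNC0.ringWinU c y u = true).card : ℝ)
      ≤ θ * (2 : ℝ) ^ n := by
  set K : ℝ := 81 with hK
  have hKpos : 0 < K := by rw [hK]; norm_num
  have hθ : 1 - (2 : ℝ)⁻¹ ^ (2 * gadL q) / K < 1 := by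
    have : (0 : ℝ) < (2 : ℝ)⁻¹ ^ (2 * gadL q) / K := by positivity
    linarith
  refine ⟨1 - (2 : ℝ)⁻¹ ^ (2 * gadL q) / K, hθ, gadL q, ?_⟩
  intro n m c y hm hmn hA hB
  have hmain := pow_le_card_lose_counter (n := n) c y hq hm hmn hA hB
  have hmainR : (2 : ℝ) ^ (m - gadL q) * (2 : ℝ) ^ (n - (m + gadL q))
      ≤ K * ((univ.filter fun u : Fin n → Bool => ¬ ringWinU c y u = true).card : ℝ) := by
    rw [hK]; exact_mod_cast hmain
  have htot : ((univ.filter fun u : Fin n → Bool => ringWinU c y u = true).card : ℝ)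
      + ((univ.filter fun u : Fin n → Bool => ¬ ringWinU c y u = true).card : ℝ) = (2 : ℝ) ^ n := by
    have h := card_filter_add_card_filter_not (s := (univ : Finset (Fin n → Bool)))
      (fun u : Fin n → Bool => ringWinU c y u = true)
    rw [card_univ, Fintype.card_fun, Fintype.card_bool, Fintype.card_fin] at h
    exact_mod_cast h
  have hpow : (2 : ℝ) ^ (m - gadL q) * (2 : ℝ) ^ (n - (m + gadL q)) = (2 : ℝ)⁻¹ ^ (2 * gadL q) * (2 : ℝ) ^ n := by
    have e1 : (2 : ℝ) ^ (m - gadL q) * (2 : ℝ) ^ (n - (m + gadL q)) = (2 : ℝ) ^ (n - 2 * gadL q) := by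
      rw [← pow_add]; congr 1; omega
    have e2 : (2 : ℝ) ^ n = (2 : ℝ) ^ (2 * gadL q) * (2 : ℝ) ^ (n - 2 * gadL q) := by
      rw [← pow_add]; congr 1; omega
    rw [e1, e2, ← mul_assoc, inv_pow, inv_mul_cancel₀ (by positivity), one_mul]
  rw [hpow] at hmainR
  have hlose : (2 : ℝ)⁻¹ ^ (2 * gadL q) / K * (2 : ℝ) ^ n
      ≤ ((univ.filter fun u : Fin n → Bool => ¬ ringWinU c y u = true).card : ℝ) := by
    rw [div_mul_eq_mul_div, div_le_iff₀ hKpos]; linarith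
  have : ((univ.filter fun u : Fin n → Bool => ringWinU c y u = true).card : ℝ)
      ≤ (2 : ℝ) ^ n - (2 : ℝ)⁻¹ ^ (2 * gadL q) / K * (2 : ℝ) ^ n := by linarith
  linarith [this]

end Summit.QuantumAdvantage.AdviceFreeQNC0.OddConfig

namespace Summit.QuantumAdvantage.QuantumAdvantage.Theorems

set_option linter.dupNamespace false

/-- **Item stmt-QuantumAdvantage-24098 `CounterAffinePairLaw` (route OddPrimeWalk, support, rank 9; planner qa-qnc0-p2 g30 ROUND-30 §2,
THM 30-A; prover qn-prover-3 g19).**  For `q % 3 ≠ 0` there are `θ_q < 1` and `m₀` such that if across a separator `m` (both sides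
`≥ m₀`) every cut reads the OTHER side only through the foreign weight mod `q` and an `𝔽₂`-affine function of the foreign bits
(data depending arbitrarily on the own side and on that residue), then `#WIN ≤ θ_q·2ⁿ`. -/
theorem oddPrimeWalk_counterAffinePairLaw :
    ∀ q : ℕ, q % 3 ≠ 0 → ∃ θ : ℝ, θ < 1 ∧ ∃ m₀ : ℕ, ∀ n m c : ℕ, ∀ y : Fin (n + 1) → (Fin n → Bool) → Bool, m₀ ≤ m → m + m₀ ≤ n → (∀ g : Fin (n + 1), g.val ≤ m → ∃ a₀ : (Fin n → Bool) → ℕ → Bool, ∃ A : (Fin n → Bool) → ℕ → Finset (Fin n), ∀ u : Fin n → Bool, y g u = Bool.xor (a₀ (fun i => decide (i.val < m) && u i) ((Finset.univ.filter fun i : Fin n => m ≤ i.val ∧ u i = true).card % q)) (decide (((A (fun i => decide (i.val < m) && u i) ((Finset.univ.filter fun i : Fin n => m ≤ i.val ∧ u i = true).card % q)).filter fun i : Fin n => m ≤ i.val ∧ u i = true).card % 2 = 1))) → (∀ g : Fin (n + 1), m < g.val → ∃ a₀ : (Fin n → Bool) → ℕ → Bool, ∃ A : (Fin n → Bool) →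 ℕ → Finset (Fin n), ∀ u : Fin n → Bool, y g u = Bool.xor (a₀ (fun i => decide (m ≤ i.val) && u i) ((Finset.univ.filter fun i : Fin n => i.val < m ∧ u i = true).card % q)) (decide (((A (fun i => decide (m ≤ i.val) && u i) ((Finset.univ.filter fun i : Fin n => i.val < m ∧ u i = true).card % q)).filter fun i : Fin n => i.val < m ∧ u i = true).card % 2 = 1))) → ((Finset.univ.filter fun u : Fin n → Bool => Summit.QuantumAdvantage.AdviceFreeQNC0.ringWinU c y u = true).card : ℝ) ≤ θ * (2 : ℝ) ^ n := by
  intro q hq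
  exact Summit.QuantumAdvantage.AdviceFreeQNC0.OddConfig.counterAffinePairLaw_card q hq

end Summit.QuantumAdvantage.QuantumAdvantage.Theorems
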